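import Summits.RiemannHypothesis.RiemannHypothesis.Theses.LiRephasingBarrier
import Summits.RiemannHypothesis.RiemannHypothesis.Theorems.Splittings.LiRephasingMovingCut
import HarnessLib

/-!
# Route LiRephasingBarrier (L5) — the RUNG target `RephasedLowPhaseLawFails` (B18 end-to-end, L-P(P1), RH-FREE)

Item stmt-RiemannHypothesis-22316 is, verbatim, the ∀-closure (over the sparsity sequence) of the tree theorem
`Summit.RiemannHypothesis.RiemannHypothesis.Theorems.Splittings.LiRephasingMovingCut.rephasing_kills_lowPhaseLaw`
(lane (xi-q) carve Q6, Theorems/Splittings/LiRephasingMovingCut.lean l.238: one counting-invisible sparse re-phasing of the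
zeta ordinates kills every low-phase floor `K − ½ log n` at the moving cut `√n log n`). One-line closer, cited by name
(equivalently `Theses.LiRephasingBarrier.closes` over the three landed item proofs). RH-free barrier-side record (B18): it
evaluates no `λ_n` and says nothing about ζ's own low sums; no summit is proved by this; nothing here bears on the truth of RH.
-/

-- D-0017: `Summit.RiemannHypothesis.RiemannHypothesis.…` duplicates the namespace BY DESIGN (single-problem summit).
set_option linter.dupNamespace false

namespace Summit.RiemannHypothesis.RiemannHypothesis.Theorems.LiRephasingBarrier

/-- **Target `RephasedLowPhaseLawFails` (item stmt-RiemannHypothesis-22316) holds** — the tree theorem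
`Splittings.LiRephasingMovingCut.rephasing_kills_lowPhaseLaw`, by name. RH-free. -/
theorem rephasedLowPhaseLawFails_proof :
    Summit.RiemannHypothesis.RiemannHypothesis.Theses.LiRephasingBarrier.RephasedLowPhaseLawFails :=
  fun mseq hm ↦ Splittings.LiRephasingMovingCut.rephasing_kills_lowPhaseLaw mseq hm

end Summit.RiemannHypothesis.RiemannHypothesis.Theorems.LiRephasingBarrier
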